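import Literature.GroupTheory.CombinatorialGroupTheory.FreeGroupQuotientOrders
import Mathlib.GroupTheory.PushoutI
import Mathlib.Data.ZMod.QuotientGroup
import HarnessLib

/-!
# Synchronised finite quotients of a cyclic amalgam of free groups: `∗_ℤ F(α_i) → ∗_{ℤ/L} (F(α_i)/N_i)`

Topic `Literature/GroupTheory/CombinatorialGroupTheory`; theorems only.  Let `G_i = F(α_i)` (`i` in a
finite nonempty index type, each `α_i` finite) be free groups of finite rank and
`φ_i : ℤ →* G_i` INJECTIVE (`n ↦ c_i ^ n`, `c_i ≠ 1`), so that `P = ∗_ℤ G_i = Monoid.PushoutI φ` is a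
free product with cyclic amalgamation (for `S_g`: the tree's `SurfaceGroupPushout`).  The
**compatible-quotients step of Baumslag's residual-finiteness theorem** (G. Baumslag, Trans. AMS 106
(1963) §§3–4; used verbatim by Dyer 1980 Thm. 4/7/10 and Tang 1997 Lemma 2.4 for conjugacy
separability), extracted from the tree's `CyclicAmalgamResiduallyFinite.lean` as a reusable statement:

* `exists_synced_quotientAmalgam` — given, for each factor, a normal subgroup `N₀ i` of finite index
  (any MONOTONE requirement already secured), a finite set `A i` disjoint from `⟨c_i⟩` (letters to be
  kept off the amalgamated subgroup) and a modulus `L₀ ≥ 1`, there are ONE common `L` with `L₀ ∣ L`,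
  normal finite-index `N i ≤ N₀ i` with `c_i ^ j ∈ N i ↔ L ∣ j` (the image of `c_i` has order EXACTLY
  `L` in every factor — order control `exists_normal_finiteIndex_zpow_mem_iff`, synchronised by taking
  `L = L₀ · ∏ m₀_i · o_i`), `⟨c_i⟩ N_i ∩ A_i = ∅`, INJECTIVE structure maps
  `φq i : ℤ/L ↪ G_i/N_i` (so that every reduced-word theorem of the tree applies to the finite amalgam
  `P̄ = ∗_{ℤ/L} (G_i/N_i) = PushoutI φq`), and the homomorphism `Π : P →* P̄` compatible with the factor
  projections and the base maps (named `Pmap` in the statement).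

No definitions: the data are delivered existentially (consumers `obtain` them).  This is the frame
("D5a") into which the case analysis of the finite-quotient route to the conjugacy separability of
`∗_ℤ F(α_i)` (Dyer 1980 Thm. 10) — hence of orientable surface groups (Stebe 1972 Thm. 3.3, the tree's
named fact `SurfaceGroupConjugacySeparable`) — plugs; nothing about those is claimed here.

## References

* G. Baumslag, *On the residual finiteness of generalised free products of nilpotent groups*, Trans.
  Amer. Math. Soc. 106 (1963) 193–209, §§3–4. [Baumslag1963]
* J. L. Dyer, *Separating conjugates in amalgamated free products and HNN extensions*, J. Austral.
  Math. Soc. Ser. A 29 (1980) 35–51, proofs of Thm. 4 and Thm. 7. [Dyer1980]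
-/

namespace Literature.GroupTheory.CombinatorialGroupTheory

open Monoid Monoid.PushoutI Function

universe u v

variable {ι : Type u} {α : ι → Type v}

/-- The generator `c_i = φ_i(1)` and its powers: `φ_i (ofAdd n) = c_i ^ n`. [folklore] -/
private theorem apply_ofAdd_eq_zpow (φ : ∀ i, Multiplicative ℤ →* FreeGroup (α i)) (i : ι) (n : ℤ) :
    φ i (Multiplicative.ofAdd n) = (φ i (Multiplicative.ofAdd 1)) ^ n := by
  have : Multiplicative.ofAdd n = (Multiplicative.ofAdd (1 : ℤ)) ^ n := by
    rw [← ofAdd_zsmul, smul_eq_mul, mul_one]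
  rw [this, map_zpow]

/-- The range of `φ_i` is `⟨c_i⟩`. [folklore] -/
private theorem range_eq_zpowers (φ : ∀ i, Multiplicative ℤ →* FreeGroup (α i)) (i : ι) :
    ((φ i).range : Set (FreeGroup (α i))) = Subgroup.zpowers (φ i (Multiplicative.ofAdd 1)) := by
  ext x
  simp only [SetLike.mem_coe, MonoidHom.mem_range, Subgroup.mem_zpowers_iff]
  constructor
  · rintro ⟨n, rfl⟩
    exact ⟨Multiplicative.toAdd n, by rw [← apply_ofAdd_eq_zpow]; rfl⟩
  · rintro ⟨n, rfl⟩
    exact ⟨Multiplicative.ofAdd n, apply_ofAdd_eq_zpow φ i n⟩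

/-- **Synchronised finite quotients of a cyclic amalgam of free groups** (Baumslag's
compatible-quotients step; Dyer 1980 proofs of Thm. 4/7; "D5a").  See the module docstring.
[cite: Baumslag1963, §§3–4] -/
theorem exists_synced_quotientAmalgam [Finite ι] [Nonempty ι] [∀ i, Finite (α i)]
    (φ : ∀ i, Multiplicative ℤ →* FreeGroup (α i)) (hφ : ∀ i, Injective (φ i))
    (N₀ : ∀ i, Subgroup (FreeGroup (α i))) [hN₀n : ∀ i, (N₀ i).Normal] [hN₀f : ∀ i, (N₀ i).FiniteIndex]
    (A : ∀ i, Set (FreeGroup (α i))) (hA : ∀ i, (A i).Finite)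
    (hAc : ∀ i, Disjoint ((φ i).range : Set (FreeGroup (α i))) (A i))
    (L₀ : ℕ) (hL₀ : 0 < L₀) :
    ∃ (L : ℕ) (N : ∀ i, Subgroup (FreeGroup (α i))) (_ : ∀ i, (N i).Normal)
      (φq : ∀ i, Multiplicative (ZMod L) →* FreeGroup (α i) ⧸ N i)
      (Pmap : PushoutI φ →* PushoutI φq),
      L₀ ∣ L ∧ 0 < L ∧
      (∀ i, (N i).FiniteIndex) ∧ (∀ i, N i ≤ N₀ i) ∧
      (∀ i, Injective (φq i)) ∧
      (∀ i (j : ℤ), φ i (Multiplicative.ofAdd j) ∈ N i ↔ (L : ℤ) ∣ j) ∧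
      (∀ i, Disjoint (((φ i).range ⊔ N i : Subgroup (FreeGroup (α i))) : Set (FreeGroup (α i))) (A i)) ∧
      (∀ i (g : FreeGroup (α i)),
        Pmap ((of (φ := φ) i : FreeGroup (α i) →* PushoutI φ) g) =
          (of (φ := φq) i : (FreeGroup (α i) ⧸ N i) →* PushoutI φq) (QuotientGroup.mk g)) ∧
      (∀ n : ℤ, Pmap (base φ (Multiplicative.ofAdd n)) =
        base φq (Multiplicative.ofAdd ((n : ℤ) : ZMod L))) ∧
      (∀ i (n : ℤ), φq i (Multiplicative.ofAdd ((n : ℤ) : ZMod L)) =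
        QuotientGroup.mk (φ i (Multiplicative.ofAdd n))) := by
  classical
  haveI : Fintype ι := Fintype.ofFinite ι
  -- the generators `c i`
  let c : ∀ i, FreeGroup (α i) := fun i => φ i (Multiplicative.ofAdd 1)
  have hφc : ∀ (i) (n : ℤ), φ i (Multiplicative.ofAdd n) = c i ^ n := apply_ofAdd_eq_zpow φ
  have hrange : ∀ i, ((φ i).range : Set (FreeGroup (α i))) = Subgroup.zpowers (c i) :=
    range_eq_zpowers φ
  have hc : ∀ i, c i ≠ 1 := by
    intro i h
    have h2 : φ i (Multiplicative.ofAdd 1) = φ i (Multiplicative.ofAdd 0) := by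
      rw [show (Multiplicative.ofAdd (0 : ℤ)) = 1 from rfl, (φ i).map_one]; exact h
    exact one_ne_zero (Multiplicative.ofAdd.injective (hφ i h2))
  have hAc' : ∀ i, Disjoint ((Subgroup.zpowers (c i) : Subgroup _) : Set (FreeGroup (α i))) (A i) :=
    fun i => by rw [← hrange]; exact hAc i
  -- order control with separation in each factor
  have hoc := fun i => exists_normal_finiteIndex_zpow_mem_iff (c i) (hc i) (A i) (hA i) (hAc' i)
  choose m₀ hm₀ hN' using hoc
  -- the orders `o i` of `c i` in the prescribed quotients `G_i / N₀ i`
  haveI : ∀ i, Finite (FreeGroup (α i) ⧸ N₀ i) := fun i => Subgroup.finite_quotient_of_finiteIndex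
  let o : ι → ℕ := fun i => orderOf (QuotientGroup.mk (c i) : FreeGroup (α i) ⧸ N₀ i)
  have ho : ∀ i, 0 < o i := fun i => orderOf_pos _
  have hoN₀ : ∀ (i) (j : ℤ), c i ^ j ∈ N₀ i ↔ (o i : ℤ) ∣ j := by
    intro i j
    rw [← QuotientGroup.eq_one_iff, QuotientGroup.mk_zpow, orderOf_dvd_iff_zpow_eq_one]
  -- the common order `L = L₀ · ∏ (m₀ i · o i)`
  let L : ℕ := L₀ * ∏ i, (m₀ i * o i)
  have hprodpos : 0 < ∏ i, (m₀ i * o i) := Finset.prod_pos fun i _ => Nat.mul_pos (hm₀ i) (ho i)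
  have hLpos : 0 < L := Nat.mul_pos hL₀ hprodpos
  have hL₀L : L₀ ∣ L := Dvd.intro _ rfl
  have hmoL : ∀ i, m₀ i * o i ∣ L := fun i =>
    (Finset.dvd_prod_of_mem (fun i => m₀ i * o i) (Finset.mem_univ i)).mul_left L₀
  have hLi : ∀ i, ∃ t, 0 < t ∧ L = m₀ i * t := by
    intro i
    obtain ⟨r, hr⟩ := hmoL i
    refine ⟨o i * r, ?_, by rw [hr]; ring⟩
    refine Nat.mul_pos (ho i) (Nat.pos_of_ne_zero fun h => ?_)
    rw [h, mul_zero] at hr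
    exact hLpos.ne' hr
  choose t ht hLt using hLi
  have hN'' := fun i => hN' i (t i) (ht i)
  choose N' hN'n hN'f hN'c hN'A using hN''
  -- the synchronised subgroups `N i = N' i ⊓ N₀ i`
  let N : ∀ i, Subgroup (FreeGroup (α i)) := fun i => N' i ⊓ N₀ i
  haveI hNn : ∀ i, (N i).Normal := fun i => by
    haveI := hN'n i; exact Subgroup.normal_inf_normal _ _
  haveI hNf : ∀ i, (N i).FiniteIndex := fun i => by
    haveI := hN'f i; haveI := hN₀f i
    change (N' i ⊓ N₀ i).FiniteIndex
    infer_instance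
  have hNle : ∀ i, N i ≤ N₀ i := fun i => inf_le_right
  have hNc : ∀ (i) (j : ℤ), c i ^ j ∈ N i ↔ (L : ℤ) ∣ j := by
    intro i j
    change c i ^ j ∈ N' i ⊓ N₀ i ↔ _
    rw [Subgroup.mem_inf, hN'c, hoN₀, ← hLt i]
    constructor
    · exact fun h => h.1
    · intro h
      exact ⟨h, (Int.natCast_dvd_natCast.2 ((dvd_mul_left (o i) (m₀ i)).trans (hmoL i))).trans h⟩
  have hNA : ∀ i, Disjoint ((((φ i).range ⊔ N i : Subgroup (FreeGroup (α i))) : Set (FreeGroup (α i))))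
      (A i) := by
    intro i
    have hle : (φ i).range ⊔ N i ≤ Subgroup.zpowers (c i) ⊔ N' i := by
      refine sup_le_sup ?_ inf_le_left
      rw [← SetLike.coe_subset_coe, hrange]
    exact Set.disjoint_of_subset_left (fun x hx => hle hx) (hN'A i)
  -- the finite quotients and the embedded cyclic group `ℤ/L`
  haveI : NeZero L := ⟨hLpos.ne'⟩
  let Gq : ι → Type v := fun i => FreeGroup (α i) ⧸ N i
  let π : ∀ i, FreeGroup (α i) →* Gq i := fun i => QuotientGroup.mk' (N i)
  let f : ∀ i, ℤ →+ Additive (Gq i) := fun i =>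
    AddMonoidHom.toMultiplicativeLeft.symm ((π i).comp (φ i))
  have hf : ∀ (i) (n : ℤ), f i n = Additive.ofMul (π i (c i ^ n)) := by
    intro i n
    change Additive.ofMul (π i (φ i (Multiplicative.ofAdd n))) = _
    rw [hφc]
  have hfL : ∀ i, f i L = 0 := by
    intro i
    rw [hf]
    have : π i (c i ^ (L : ℤ)) = 1 := (QuotientGroup.eq_one_iff _).mpr ((hNc i L).mpr (dvd_refl _))
    rw [this]; rfl
  let φq : ∀ i, Multiplicative (ZMod L) →* Gq i := fun i =>
    AddMonoidHom.toMultiplicativeLeft (ZMod.lift L ⟨f i, hfL i⟩)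
  have hφq : ∀ (i) (n : ℤ), φq i (Multiplicative.ofAdd (n : ZMod L)) = π i (c i ^ n) := by
    intro i n
    change Additive.toMul (ZMod.lift L ⟨f i, hfL i⟩ (n : ZMod L)) = _
    rw [ZMod.lift_coe]
    change Additive.toMul (f i n) = _
    rw [hf]; rfl
  have hφq_inj : ∀ i, Injective (φq i) := by
    intro i
    rw [← MonoidHom.ker_eq_bot_iff, Subgroup.eq_bot_iff_forall]
    intro x hx
    obtain ⟨n, hn⟩ := ZMod.intCast_surjective (Multiplicative.toAdd x)
    have hx' : x = Multiplicative.ofAdd (n : ZMod L) := by rw [hn]; rfl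
    rw [MonoidHom.mem_ker, hx', hφq] at hx
    have hx2 : (L : ℤ) ∣ n := (hNc i n).mp ((QuotientGroup.eq_one_iff _).mp hx)
    rw [hx', (ZMod.intCast_zmod_eq_zero_iff_dvd n L).mpr hx2]
    rfl
  -- the induced map of amalgams
  let q : Multiplicative ℤ →* Multiplicative (ZMod L) :=
    AddMonoidHom.toMultiplicative (Int.castAddHom (ZMod L))
  have hq : ∀ n : ℤ, q (Multiplicative.ofAdd n) = Multiplicative.ofAdd (n : ZMod L) := fun _ => rfl
  let Pmap : PushoutI φ →* PushoutI φq :=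
    PushoutI.lift (fun i => (of i).comp (π i)) ((base φq).comp q) fun i => by
      refine MonoidHom.ext_mint ?_
      simp only [MonoidHom.comp_apply]
      rw [hφc, hq, ← hφq, of_apply_eq_base]
  refine ⟨L, N, hNn, φq, Pmap, hL₀L, hLpos, hNf, hNle, hφq_inj, ?_, hNA, ?_, ?_, ?_⟩
  · intro i j
    rw [hφc]
    exact hNc i j
  · intro i g
    simp only [Pmap, PushoutI.lift_of, MonoidHom.comp_apply, π]
    rfl
  · intro n
    simp only [Pmap, PushoutI.lift_base, MonoidHom.comp_apply, hq]
  · intro i n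
    rw [hφq, hφc]
    rfl

end Literature.GroupTheory.CombinatorialGroupTheory
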